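import Literature.Probability.Percolation.Percolation
import HarnessLib

/-!
# Crux `PercNearOneGluing.AdditiveGluing` (stmt-CriticalPhenomena-4576), observer-exploration line — definitions

The objects of the BFS OBSERVER EXPLORATION (cell `prim-png-dp-al5` gen 7, memo `EXPLORE-g7.md` §1): for a forbidden vertex set `N`
(in the application `N = A ∪ {b}`: relays and target), an observer `o` and a configuration `ω`,
* `ExploreBFS.layer N o ω t` — the vertices reached from `o` after `t` rounds of propagation along open pairs FROM vertices outside `N`
  (vertices of `N` are absorbed but do not propagate);
* `ExploreBFS.ContactFree N o ω t` — no vertex of `N` has been reached in rounds `≤ t`;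
* `ExploreBFS.blob N o ω` — the PRE-CONTACT BLOB: the union of the contact-free layers;
* `ExploreBFS.contacts N o ω` — the vertices outside the blob joined to it by an open pair (the layer revealed at the stopping round:
  it meets `N` unless the exploration died, in which case it is empty);
* `ExploreBFS.leafEvent N o (U, B) = {blob = U, contacts = B}` and the index type `ExploreBFS.LeafIdx N o` of non-empty leaves.
These form the leaf system to which `LeafSystem.*` (`…AdditiveGluingLeafSystem.lean`) and `BlobTransfer.*` apply; the companion proof file
`…AdditiveGluingExploreBFS.lean` establishes their properties (locality, STAR, JOIN, dead leaves) and the reductions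
`ExploreBFS.additiveGluing_of_SAU`, `ExploreBFS.preFKG_of_hereditary`.  Nothing is asserted here.
-/

noncomputable section

namespace Summit.CriticalPhenomena.PercolationContinuityZ3.Theorems

open Set Literature.Probability.Percolation

namespace ExploreBFS

variable {V : Type*}

/-- The BFS layers of the observer exploration: `layer 0 = {o}`, and round `t+1` adds every vertex joined by an open pair to a vertex of
round `≤ t` lying OUTSIDE the forbidden set `N` (vertices of `N` are reached but never propagate). [this work] -/
def layer (N : Set V) (o : V) (ω : BondConfig V) : ℕ → Set V
  | 0 => {o}
  | t + 1 => layer N o ω t ∪ {v | ∃ u ∈ layer N o ω t, u ∉ N ∧ u ≠ v ∧ s(u, v) ∈ ω}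

/-- No forbidden vertex is reached in rounds `≤ t` (a predicate of the configuration; not a named fact). [this work] -/
def ContactFree (N : Set V) (o : V) (ω : BondConfig V) (t : ℕ) : Prop :=
  ∀ s ≤ t, ∀ v ∈ layer N o ω s, v ∉ N

/-- The pre-contact blob: all vertices reached in contact-free rounds. [this work] -/
def blob (N : Set V) (o : V) (ω : BondConfig V) : Set V :=
  {v | ∃ t, ContactFree N o ω t ∧ v ∈ layer N o ω t}

/-- The contact set: vertices outside the blob joined to a blob vertex by an open pair. [this work] -/
def contacts (N : Set V) (o : V) (ω : BondConfig V) : Set V :=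
  {v | v ∉ blob N o ω ∧ ∃ u ∈ blob N o ω, u ≠ v ∧ s(u, v) ∈ ω}

/-- The leaf event of the pair `(U, B)`: `{blob = U, contacts = B}`. [this work] -/
abbrev leafEvent (N : Set V) (o : V) (p : Finset V × Finset V) : Set (BondConfig V) :=
  {ω | blob N o ω = (↑p.1 : Set V) ∧ contacts N o ω = (↑p.2 : Set V)}

/-- The index type of the BFS leaf system: pairs `(U, B)` of finsets whose leaf event is non-empty. [this work] -/
abbrev LeafIdx (N : Set V) (o : V) : Type _ := {p : Finset V × Finset V // (leafEvent N o p).Nonempty}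

end ExploreBFS

end Summit.CriticalPhenomena.PercolationContinuityZ3.Theorems
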